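import Mathlib
import Summits.QuantumFields.YangMills.Theses.AntiScreeningCeilings

/-!
# Route `AntiScreeningCeilings` — the Assembly item (stmt-QuantumFields-27237)

`Assembly : MonotoneMirrorTransfer → ScaleMonotonicity → MaximalSeparationCeiling → SqrtDominationC → FactorialCalibrationC →
OnsetFloorsC → leaf`.  Proof: the transfer support gives `SquareRootCeilings.SubOnsetTwoPointCeilings` from the two new cruxes; the LANDED
`SquareRootCeilings.assembly_proof` (p615961) and `SquareRootCeilings.dominationTransfer_proof` (p617571) do the rest.  This proves only the
implication (the assembly), none of its hypotheses; no summit / leaf / NT / UV / IR statement is proved here (ym-idea-11 g4, LINE A).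
-/

set_option autoImplicit false

namespace Summit.QuantumFields.YangMills.Theses.AntiScreeningCeilings

/-- closes the assembly item stmt-QuantumFields-27237. -/
theorem assembly_proof : Assembly :=
  fun hT hM hO hD hC hF =>
    Summit.QuantumFields.YangMills.Theses.SquareRootCeilings.assembly_proof hD (hT hM hO)
      Summit.QuantumFields.YangMills.Theses.SquareRootCeilings.dominationTransfer_proof hC hF

end Summit.QuantumFields.YangMills.Theses.AntiScreeningCeilings
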